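import Literature.NumberTheory.Automorphic.SchwartzBruhatLatticeSpan
import Literature.NumberTheory.Automorphic.GodementJacquetZetaHeckeShift
import Literature.NumberTheory.Automorphic.GLnGelfandKazhdanInvolution
import HarnessLib

/-!
# Zeta integrals of the zonal spherical function against lattice indicators

Topic `NumberTheory/Automorphic`; theorems only (no definition, no named fact). Second support
file of the discharge of `GodementJacquet1972_hasGJLFactor_of_isSatakeParameter`
(`GodementJacquetLocal`; Godement–Jacquet, LNM 260 (1972), §6 with Thm. 3.3: the unramified
`L`-factor `L(s, π) = ∏ (1 - α_i q^{-s})⁻¹`). Setting: `F` a non-archimedean local field, `ρ` a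
representation of `GL_n(F)` on a complex vector space, `K = GL_n(𝒪)`, `M = M_n(𝒪)`,
`Z(Φ, s, f) = ∫ Φ(x) f(x) |det x|^s dμ(x)` (`gjLocalZeta`), `ω(g) = φ(ρ(g) v)` a coefficient.

* `pseudoMetrizableSpace_generalLinearGroup`, `isMulRightInvariant_of_isHaarMeasure_gl`: the
  congruence subgroups are a countable basis at `1`, so `GL_n(F)` is pseudo-metrisable, every
  Haar measure on it is regular, and (unimodularity, `isMulRightInvariant_generalLinearGroup` of
  `GLnGelfandKazhdanInvolution`) **every Haar measure on `GL_n(F)` is right invariant**.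
* `gjLocalZeta_matrixCoeff_dual` (**translating the linear form**):
  `Z(Φ, s, ⟨ρ(·) u, ρ̃(h) ψ⟩) = |det h|^s Z(Φ(h ·), s, ⟨ρ(·) u, ψ⟩)` (left invariance).
* `exists_gjLocalZeta_eq_sum_indicator` (**lattice reduction of the test function**): for
  `Ψ ∈ 𝒮(M_n(F))` there are finitely many `c_i`, `z_i` with
  `Z(Ψ, s, f) = ∑_i c_i Z(1_M(z_i⁻¹ ·), s, f)` for every right-`K`-invariant `f` whose zeta
  integrals against Schwartz–Bruhat functions converge absolutely at `s` (right-average `Ψ` over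
  `K / K_m`, which does not change `Z`, and expand by
  `exists_eq_sum_indicator_intMatrices_of_mem_schwartzBruhat`).
* `gjLocalZeta_indicator_mul_left_eq_spherical` (**the functional equation of the zonal
  spherical function inside the zeta integral**): for `ρ` smooth and spherical, `v ∈ V^K`,
  `φ ∈ Ṽ^K`, `φ(v) = 1`, `ω = ⟨ρ(·) v, φ⟩`:
  `Z(1_M(z⁻¹ ·), s, ω) = |det z|^s ω(z) Z(1_M, s, ω)` — substitute `x ↦ z x` and average the
  smooth form `ρ̃(z⁻¹) φ` over `K`, which lands in `Ṽ^K = ℂ φ`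
  (`IsSmooth.dual_eq_zero_of_forall_mem_fixedPoints`, `eq_smul_of_isSpherical`); this is
  `∫_K ω(z k x) dk = ω(z) ω(x)` (Cartier (1979), §IV; Macdonald (1971), (1.2)).

## References

* R. Godement, H. Jacquet, *Zeta functions of simple algebras*, LNM 260 (1972), §6, Lemma 6.10
  [GodementJacquet1972] (not held; statements as recorded in `GodementJacquetLocal`).
* P. Cartier, *Representations of 𝔭-adic groups: a survey*, Proc. Sympos. Pure Math. 33 (1979),
  part 1, §IV (spherical functions) [CartierCorvallis1979].
* I. G. Macdonald, *Spherical functions on a group of 𝔭-adic type* (Madras, 1971), Ch. I.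
-/

set_option autoImplicit false

noncomputable section

open scoped MatrixGroups NNReal
open Matrix ValuativeRel

namespace Literature.NumberTheory.Automorphic

/-! ### Haar measures on `GL_n(F)` are right invariant -/

section Haar

open _root_.MeasureTheory _root_.Topology Filter TopologicalSpace
  Literature.NumberTheory.GaloisRepresentations.IsNonarchimedeanLocalField

variable {F : Type*} [Field F] [ValuativeRel F] [TopologicalSpace F] [IsNonarchimedeanLocalField F]
  (n : ℕ)

variable (F) in
/-- `GL_n(F)` is pseudo-metrisable: the principal congruence subgroups `K_m` form a countable
neighbourhood basis of `1` (`exists_congruenceGL_pow_subset`), so the right uniformity of the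
topological group `GL_n(F)` is countably generated. A theorem to be invoked with `haveI`.
[folklore] -/
theorem pseudoMetrizableSpace_generalLinearGroup : PseudoMetrizableSpace (GL (Fin n) F) := by
  obtain ⟨ϖ, hϖ⟩ := exists_isUniformizingElement (F := F)
  have hb : (𝓝 (1 : GL (Fin n) F)).HasBasis (fun _ : ℕ => True)
      (fun m => (congruenceGL n (valuation F ϖ ^ m) : Set (GL (Fin n) F))) := by
    refine ⟨fun U => ⟨fun hU => ?_, fun ⟨m, _, hm⟩ => ?_⟩⟩
    · obtain ⟨m, -, hsub⟩ := exists_congruenceGL_pow_subset hϖ hU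
      exact ⟨m, trivial, hsub⟩
    · exact Filter.mem_of_superset ((isOpen_congruenceGL (pow_ne_zero _
        ((Valuation.ne_zero_iff _).mpr hϖ.ne_zero))).mem_nhds (Subgroup.one_mem _)) hm
  haveI : (𝓝 (1 : GL (Fin n) F)).IsCountablyGenerated := hb.isCountablyGenerated
  refine ⟨⟨IsTopologicalGroup.rightUniformSpace (GL (Fin n) F), rfl, ?_⟩⟩
  change (Filter.comap (fun p : GL (Fin n) F × GL (Fin n) F => p.2 * p.1⁻¹) (𝓝 1)).IsCountablyGenerated
  infer_instance

variable {n}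
variable [MeasurableSpace (GL (Fin n) F)] [BorelSpace (GL (Fin n) F)]

/-- **Every Haar measure on `GL_n(F)` is right invariant** (`GL_n(F)` is unimodular,
`isMulRightInvariant_generalLinearGroup`; the inner regularity needed there is automatic, Haar
measures on the `σ`-compact pseudo-metrisable group `GL_n(F)` being regular). [folklore] -/
theorem isMulRightInvariant_of_isHaarMeasure_gl (μ : Measure (GL (Fin n) F)) [μ.IsHaarMeasure] :
    μ.IsMulRightInvariant := by
  haveI : PseudoMetrizableSpace (GL (Fin n) F) := pseudoMetrizableSpace_generalLinearGroup F n
  haveI : SigmaCompactSpace (GL (Fin n) F) := sigmaCompactSpace_generalLinearGroup F n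
  exact isMulRightInvariant_generalLinearGroup μ

end Haar

/-! ### Substitutions and linearity in the zeta integral -/

section Zeta

open _root_.MeasureTheory Literature.NumberTheory.GaloisRepresentations.IsNonarchimedeanLocalField

variable {F : Type*} [Field F] [ValuativeRel F] [TopologicalSpace F] [IsNonarchimedeanLocalField F]
  {n : ℕ} [MeasurableSpace (GL (Fin n) F)] [BorelSpace (GL (Fin n) F)]
  {V : Type*} [AddCommGroup V] [Module ℂ V] (ρ : Representation ℂ (GL (Fin n) F) V)
  (μ : Measure (GL (Fin n) F))

omit [MeasurableSpace (GL (Fin n) F)] [BorelSpace (GL (Fin n) F)] in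
/-- Schwartz–Bruhat functions on `M_n(F)` are stable under `X ↦ g X` (`g ∈ GL_n(F)`, a
homeomorphism of `M_n(F)`). [folklore] -/
theorem schwartzBruhat_comp_mul_left (g : GL (Fin n) F) {Φ : Matrix (Fin n) (Fin n) F → ℂ}
    (hΦ : Φ ∈ SchwartzBruhat (Matrix (Fin n) (Fin n) F)) :
    (fun X => Φ ((g : Matrix (Fin n) (Fin n) F) * X)) ∈ SchwartzBruhat (Matrix (Fin n) (Fin n) F) := by
  let e : Matrix (Fin n) (Fin n) F ≃ₜ Matrix (Fin n) (Fin n) F :=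
    { toEquiv := Units.mulLeft g
      continuous_toFun := continuous_const.mul continuous_id
      continuous_invFun := continuous_const.mul continuous_id }
  have he : (fun X => Φ ((g : Matrix (Fin n) (Fin n) F) * X)) = Φ ∘ e := rfl
  rw [he]
  exact ⟨hΦ.1.comp_continuous e.continuous, hΦ.2.comp_homeomorph e⟩

omit [MeasurableSpace (GL (Fin n) F)] [BorelSpace (GL (Fin n) F)] in
/-- Schwartz–Bruhat functions on `M_n(F)` are stable under `X ↦ X g` (`g ∈ GL_n(F)`).
[folklore] -/
theorem schwartzBruhat_comp_mul_right (g : GL (Fin n) F) {Φ : Matrix (Fin n) (Fin n) F → ℂ}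
    (hΦ : Φ ∈ SchwartzBruhat (Matrix (Fin n) (Fin n) F)) :
    (fun X => Φ (X * (g : Matrix (Fin n) (Fin n) F))) ∈ SchwartzBruhat (Matrix (Fin n) (Fin n) F) := by
  let e : Matrix (Fin n) (Fin n) F ≃ₜ Matrix (Fin n) (Fin n) F :=
    { toEquiv := Units.mulRight g
      continuous_toFun := continuous_id.mul continuous_const
      continuous_invFun := continuous_id.mul continuous_const }
  have he : (fun X => Φ (X * (g : Matrix (Fin n) (Fin n) F))) = Φ ∘ e := rfl
  rw [he]
  exact ⟨hΦ.1.comp_continuous e.continuous, hΦ.2.comp_homeomorph e⟩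

omit [MeasurableSpace (GL (Fin n) F)] [BorelSpace (GL (Fin n) F)] [TopologicalSpace F]
  [IsNonarchimedeanLocalField F] in
/-- `1_{M_n(𝒪)}(k X) = 1_{M_n(𝒪)}(X)` for `k ∈ GL_n(𝒪)`. [folklore] -/
theorem indicator_intMatrices_glInt_mul {k : GL (Fin n) F} (hk : k ∈ glInt n F)
    (X : Matrix (Fin n) (Fin n) F) :
    (intMatrices n F).indicator (1 : Matrix (Fin n) (Fin n) F → ℂ) ((k : Matrix (Fin n) (Fin n) F) * X) =
      (intMatrices n F).indicator 1 X := by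
  by_cases hX : IsIntegralMatrix X
  · rw [Set.indicator_of_mem ((mem_intMatrices_iff _).mpr hX),
      Set.indicator_of_mem ((mem_intMatrices_iff _).mpr ((isIntegralMatrix_glInt_mul_iff hk X).mpr hX))]
    rfl
  · rw [Set.indicator_of_notMem (fun h => hX ((mem_intMatrices_iff _).mp h)),
      Set.indicator_of_notMem (fun h => hX ((isIntegralMatrix_glInt_mul_iff hk X).mp
        ((mem_intMatrices_iff _).mp h)))]

omit [BorelSpace (GL (Fin n) F)] in
/-- `Z(c Φ, s, f) = c Z(Φ, s, f)`. [folklore] -/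
theorem gjLocalZeta_const_mul_left (c : ℂ) (Φ : Matrix (Fin n) (Fin n) F → ℂ) (f : GL (Fin n) F → ℂ)
    (s : ℂ) : gjLocalZeta μ (fun X => c * Φ X) f s = c * gjLocalZeta μ Φ f s := by
  unfold gjLocalZeta
  rw [← integral_const_mul]
  refine integral_congr_ae (Filter.Eventually.of_forall fun x => ?_)
  simp only [gjLocalIntegrand]
  ring

omit [BorelSpace (GL (Fin n) F)] in
/-- `Z(Φ, s, ⟨ρ(·) v, c φ⟩) = c Z(Φ, s, ⟨ρ(·) v, φ⟩)`. [folklore] -/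
theorem gjLocalZeta_matrixCoeff_smul_left (c : ℂ) (Φ : Matrix (Fin n) (Fin n) F → ℂ)
    (φ : Module.Dual ℂ V) (v : V) (s : ℂ) :
    gjLocalZeta μ Φ (ρ.matrixCoeff (c • φ) v) s = c * gjLocalZeta μ Φ (ρ.matrixCoeff φ v) s := by
  unfold gjLocalZeta
  rw [← integral_const_mul]
  refine integral_congr_ae (Filter.Eventually.of_forall fun x => ?_)
  simp only [gjLocalIntegrand, Representation.matrixCoeff_apply, LinearMap.smul_apply, smul_eq_mul]
  ring

omit [BorelSpace (GL (Fin n) F)] in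
/-- The zeta integral `Z(Φ, s, ⟨ρ(·) v, φ⟩)` is additive in the linear form `φ` (given absolute
convergence of each term). [folklore] -/
theorem gjLocalZeta_matrixCoeff_sum_left {ι : Type*} (T : Finset ι) (Φ : Matrix (Fin n) (Fin n) F → ℂ)
    (φ : ι → Module.Dual ℂ V) (v : V) (s : ℂ)
    (hint : ∀ i ∈ T, Integrable (gjLocalIntegrand Φ (ρ.matrixCoeff (φ i) v) s) μ) :
    gjLocalZeta μ Φ (ρ.matrixCoeff (∑ i ∈ T, φ i) v) s =
      ∑ i ∈ T, gjLocalZeta μ Φ (ρ.matrixCoeff (φ i) v) s := by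
  unfold gjLocalZeta
  rw [← integral_finsetSum _ hint]
  refine integral_congr_ae (Filter.Eventually.of_forall fun x => ?_)
  simp only [gjLocalIntegrand, Representation.matrixCoeff_apply, LinearMap.sum_apply, Finset.mul_sum,
    Finset.sum_mul]

/-- **Translating the linear form of a coefficient.** For `h ∈ GL_n(F)` and a left-invariant
measure, `Z(Φ, s, ⟨ρ(·) u, ρ̃(h) ψ⟩) = |det h|^s · Z(Φ(h ·), s, ⟨ρ(·) u, ψ⟩)` where
`(ρ̃(h) ψ)(w) = ψ(ρ(h⁻¹) w)` (`Representation.dual`): substitute `x ↦ h x` (valid for the Bochner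
integral with no integrability hypothesis). [folklore] -/
theorem gjLocalZeta_matrixCoeff_dual [μ.IsMulLeftInvariant] (Φ : Matrix (Fin n) (Fin n) F → ℂ)
    (ψ : Module.Dual ℂ V) (u : V) (h : GL (Fin n) F) (s : ℂ) :
    gjLocalZeta μ Φ (ρ.matrixCoeff (ρ.dual h ψ) u) s =
      (((normAbs F ((Matrix.GeneralLinearGroup.det h : Fˣ) : F) : ℝ≥0) : ℝ) : ℂ) ^ s *
        gjLocalZeta μ (fun X => Φ ((h : Matrix (Fin n) (Fin n) F) * X)) (ρ.matrixCoeff ψ u) s := by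
  unfold gjLocalZeta
  rw [← integral_const_mul]
  conv_lhs => rw [← integral_mul_left_eq_self _ h]
  refine integral_congr_ae (Filter.Eventually.of_forall fun x => ?_)
  have h2 : ρ h⁻¹ (ρ (h * x) u) = ρ x u := by
    rw [← Module.End.mul_apply, ← map_mul, inv_mul_cancel_left]
  simp only [gjLocalIntegrand, Representation.matrixCoeff_apply, Representation.dual_apply,
    Module.Dual.transpose_apply, LinearMap.comp_apply, h2, Units.val_mul]
  rw [cpow_normAbs_det_mul h x s]
  ring

/-- Right translates of the test function by `k ∈ GL_n(𝒪)` do not change the zeta integral of a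
right-`GL_n(𝒪)`-invariant `f` (right-invariant measure; substitute `x ↦ x k`). [folklore] -/
theorem gjLocalZeta_comp_mul_glInt [μ.IsMulRightInvariant] {k : GL (Fin n) F} (hk : k ∈ glInt n F)
    (Φ : Matrix (Fin n) (Fin n) F → ℂ) {f : GL (Fin n) F → ℂ}
    (hf : ∀ k ∈ glInt n F, ∀ x : GL (Fin n) F, f (x * k) = f x) (s : ℂ) :
    gjLocalZeta μ (fun X => Φ (X * (k : Matrix (Fin n) (Fin n) F))) f s = gjLocalZeta μ Φ f s := by
  unfold gjLocalZeta
  conv_rhs => rw [← integral_mul_right_eq_self _ k]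
  refine integral_congr_ae (Filter.Eventually.of_forall fun x => ?_)
  simp only [gjLocalIntegrand, Units.val_mul, hf k hk x]
  rw [cpow_normAbs_det_mul x k s, cpow_normAbs_det_of_mem_glInt hk, mul_one]

/-! ### Lattice reduction of the test function -/

omit [MeasurableSpace (GL (Fin n) F)] [BorelSpace (GL (Fin n) F)] in
/-- **Right `GL_n(𝒪)`-average of a Schwartz–Bruhat function.** For `Ψ ∈ 𝒮(M_n(F))` there is
a non-empty finite family `κ_1, …, κ_m ∈ K = GL_n(𝒪)` (representatives of `K / K_m` for a
principal congruence subgroup `K_m` under which `Ψ` is right invariant) such that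
`X ↦ ∑_i Ψ(X κ_i)` is right `K`-invariant: `∑_i Ψ(X k κ_i) = ∑_i Ψ(X κ_i)` for `k ∈ K` (left
multiplication by `k` permutes `K / K_m`, `K_m` being normal in `K`). [folklore] -/
theorem exists_sum_comp_mul_glInt_eq {Ψ : Matrix (Fin n) (Fin n) F → ℂ}
    (hΨ : Ψ ∈ SchwartzBruhat (Matrix (Fin n) (Fin n) F)) :
    ∃ (m : ℕ) (κ : Fin m → GL (Fin n) F), 0 < m ∧ (∀ i, κ i ∈ glInt n F) ∧
      ∀ k ∈ glInt n F, ∀ X : Matrix (Fin n) (Fin n) F,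
        ∑ i, Ψ (X * (k : Matrix (Fin n) (Fin n) F) * (κ i : Matrix (Fin n) (Fin n) F)) =
          ∑ i, Ψ (X * (κ i : Matrix (Fin n) (Fin n) F)) := by
  classical
  obtain ⟨ϖ, hϖ⟩ := exists_isUniformizingElement (F := F)
  obtain ⟨m, -, hKm⟩ := exists_forall_mul_congruenceGL_eq_of_mem_schwartzBruhat hϖ hΨ
  -- `K_m` as an open normal subgroup of finite index of the compact group `K`
  set K : Subgroup (GL (Fin n) F) := glInt n F with hKdef
  haveI : CompactSpace K := isCompact_iff_compactSpace.mp (isCompact_glInt n F)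
  set N : Subgroup K := (congruenceGL n (valuation F ϖ ^ m)).subgroupOf K with hNdef
  have hNopen : IsOpen (N : Set K) := Subgroup.subgroupOf_isOpen _ _
    (isOpen_congruenceGL (pow_ne_zero _ ((Valuation.ne_zero_iff _).mpr hϖ.ne_zero)))
  haveI : N.Normal := (Subgroup.normal_subgroupOf_iff (congruenceGL_le_glInt _)).mpr
    fun h k hh hk => conj_mem_congruenceGL hk hh
  haveI : Finite (K ⧸ N) := Subgroup.quotient_finite_of_isOpen N hNopen
  haveI : Fintype (K ⧸ N) := Fintype.ofFinite _
  -- right `N`-invariance of `Ψ` and the basic reindexing step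
  have hinv : ∀ (a b : K) (X : Matrix (Fin n) (Fin n) F), (a : K ⧸ N) = b →
      Ψ (X * ((a : GL (Fin n) F) : Matrix (Fin n) (Fin n) F)) =
        Ψ (X * ((b : GL (Fin n) F) : Matrix (Fin n) (Fin n) F)) := by
    intro a b X hab
    have hmem : ((a⁻¹ * b : K) : GL (Fin n) F) ∈ congruenceGL n (valuation F ϖ ^ m) :=
      Subgroup.mem_subgroupOf.mp (QuotientGroup.eq.mp hab)
    have e : ((b : GL (Fin n) F) : Matrix (Fin n) (Fin n) F) =
        ((a : GL (Fin n) F) : Matrix (Fin n) (Fin n) F) *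
          (((a⁻¹ * b : K) : GL (Fin n) F) : Matrix (Fin n) (Fin n) F) := by
      rw [← Units.val_mul, Subgroup.coe_mul, Subgroup.coe_inv, mul_inv_cancel_left]
    rw [e, ← Matrix.mul_assoc, (hKm _ hmem _).1]
  -- the representatives
  set e := Fintype.equivFin (K ⧸ N) with hedef
  refine ⟨Fintype.card (K ⧸ N), fun i => (((e.symm i).out : K) : GL (Fin n) F), Fintype.card_pos,
    fun i => ((e.symm i).out).2, fun k hk X => ?_⟩
  rw [e.symm.sum_comp (fun q : K ⧸ N => Ψ (X * (k : Matrix (Fin n) (Fin n) F) *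
      (((q.out : K) : GL (Fin n) F) : Matrix (Fin n) (Fin n) F))),
    e.symm.sum_comp (fun q : K ⧸ N => Ψ (X * (((q.out : K) : GL (Fin n) F) : Matrix (Fin n) (Fin n) F)))]
  refine Fintype.sum_equiv (Equiv.mulLeft (((⟨k, hk⟩ : K) : K ⧸ N))) _ _ fun q => ?_
  rw [Equiv.coe_mulLeft, Matrix.mul_assoc, ← Units.val_mul]
  have hcoe : k * (((q.out : K) : GL (Fin n) F)) = (((⟨k, hk⟩ : K) * q.out : K) : GL (Fin n) F) := rfl
  rw [hcoe]
  refine hinv _ _ X ?_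
  rw [QuotientGroup.mk_mul, QuotientGroup.out_eq', QuotientGroup.out_eq']

/-- **Lattice reduction of the test function.** For `Ψ ∈ 𝒮(M_n(F))` there are finitely many
`c_i ∈ ℂ`, `z_i ∈ GL_n(F)` such that for every right-`GL_n(𝒪)`-invariant `f` on `GL_n(F)` and
every `s` at which all `Z(Φ, s, f)` (`Φ` Schwartz–Bruhat) converge absolutely,
`Z(Ψ, s, f) = ∑_i c_i · Z(1_{M_n(𝒪)}(z_i⁻¹ ·), s, f)` (right-invariant measure; the hypothesis
`1_{M_n(𝒪)} ∈ 𝒮(M_n(F))` is `indicator_intMatrices_mem_schwartzBruhat` of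
`GodementJacquetLocalProofs`, kept as an argument to avoid an import cycle). Proof:
`Z(Ψ, s, f) = Z(Ψ(· κ), s, f)` for `κ ∈ K` (`gjLocalZeta_comp_mul_glInt`), so `Z(Ψ, s, f)` is the
zeta integral of the right `K`-average of `Ψ` (`exists_sum_comp_mul_glInt_eq`), which on `GL_n(F)`
is a combination of the `1_{M}(z_i⁻¹ ·)` (`exists_eq_sum_indicator_intMatrices_of_mem_schwartzBruhat`).
[folklore] -/
theorem exists_gjLocalZeta_eq_sum_indicator [μ.IsMulRightInvariant]
    (hM : (intMatrices n F).indicator (1 : Matrix (Fin n) (Fin n) F → ℂ) ∈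
      SchwartzBruhat (Matrix (Fin n) (Fin n) F))
    {Ψ : Matrix (Fin n) (Fin n) F → ℂ} (hΨ : Ψ ∈ SchwartzBruhat (Matrix (Fin n) (Fin n) F)) :
    ∃ (m : ℕ) (c : Fin m → ℂ) (z : Fin m → GL (Fin n) F), ∀ (f : GL (Fin n) F → ℂ),
      (∀ k ∈ glInt n F, ∀ x : GL (Fin n) F, f (x * k) = f x) → ∀ s : ℂ,
      (∀ Φ ∈ SchwartzBruhat (Matrix (Fin n) (Fin n) F), Integrable (gjLocalIntegrand Φ f s) μ) →
      gjLocalZeta μ Ψ f s = ∑ i, c i * gjLocalZeta μ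
        (fun X => (intMatrices n F).indicator 1 ((((z i)⁻¹ : GL (Fin n) F) : Matrix (Fin n) (Fin n) F) * X))
        f s := by
  classical
  obtain ⟨m, κ, hm, hκ, havg⟩ := exists_sum_comp_mul_glInt_eq hΨ
  -- the right `K`-average
  set Ψav : Matrix (Fin n) (Fin n) F → ℂ := fun X => ∑ i, Ψ (X * (κ i : Matrix (Fin n) (Fin n) F))
    with hΨavdef
  have hΨav_eq : Ψav = ∑ i, fun X => Ψ (X * (κ i : Matrix (Fin n) (Fin n) F)) := by
    funext X; simp only [hΨavdef, Finset.sum_apply]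
  have hΨav : Ψav ∈ SchwartzBruhat (Matrix (Fin n) (Fin n) F) := by
    rw [hΨav_eq]
    exact Submodule.sum_mem _ fun i _ => schwartzBruhat_comp_mul_right (κ i) hΨ
  have hΨavK : ∀ k ∈ glInt n F, ∀ X : Matrix (Fin n) (Fin n) F,
      Ψav (X * (k : Matrix (Fin n) (Fin n) F)) = Ψav X := fun k hk X => havg k hk X
  obtain ⟨m', c, z, hexp⟩ := exists_eq_sum_indicator_intMatrices_of_mem_schwartzBruhat hΨav hΨavK
  refine ⟨m', fun i => (m : ℂ)⁻¹ * c i, z, fun f hf s hint => ?_⟩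
  -- `Z(Ψav) = m Z(Ψ)`
  have h1 : gjLocalZeta μ Ψav f s = m * gjLocalZeta μ Ψ f s := by
    change gjLocalZeta μ (fun X => ∑ i ∈ Finset.univ, Ψ (X * (κ i : Matrix (Fin n) (Fin n) F))) f s = _
    rw [gjLocalZeta_sum_left μ Finset.univ (fun i X => Ψ (X * (κ i : Matrix (Fin n) (Fin n) F))) f s
      (fun i _ => hint _ (schwartzBruhat_comp_mul_right (κ i) hΨ)),
      Finset.sum_congr rfl fun i _ => gjLocalZeta_comp_mul_glInt μ (hκ i) Ψ hf s, Finset.sum_const,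
      Finset.card_univ, Fintype.card_fin, nsmul_eq_mul]
  -- `Z(Ψav) = ∑ c_j Z(1_M(z_j⁻¹ ·))`
  have h2 : gjLocalZeta μ Ψav f s = ∑ j, c j * gjLocalZeta μ
      (fun X => (intMatrices n F).indicator 1 ((((z j)⁻¹ : GL (Fin n) F) : Matrix (Fin n) (Fin n) F) * X))
      f s := by
    have e : gjLocalZeta μ Ψav f s = gjLocalZeta μ (fun X => ∑ j ∈ Finset.univ, c j *
        (intMatrices n F).indicator 1 ((((z j)⁻¹ : GL (Fin n) F) : Matrix (Fin n) (Fin n) F) * X)) f s := by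
      unfold gjLocalZeta
      refine integral_congr_ae (Filter.Eventually.of_forall fun x => ?_)
      simp only [gjLocalIntegrand]
      rw [hexp x]
      simp only [Units.val_mul]
    rw [e, gjLocalZeta_sum_left μ Finset.univ (fun j X => c j *
      (intMatrices n F).indicator 1 ((((z j)⁻¹ : GL (Fin n) F) : Matrix (Fin n) (Fin n) F) * X)) f s ?_]
    · exact Finset.sum_congr rfl fun j _ => gjLocalZeta_const_mul_left μ (c j) _ f s
    · intro j _
      have hmem : (fun X => c j * (intMatrices n F).indicator (1 : Matrix (Fin n) (Fin n) F → ℂ)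
          ((((z j)⁻¹ : GL (Fin n) F) : Matrix (Fin n) (Fin n) F) * X)) ∈
          SchwartzBruhat (Matrix (Fin n) (Fin n) F) :=
        Submodule.smul_mem _ (c j) (schwartzBruhat_comp_mul_left (z j)⁻¹ hM)
      exact hint _ hmem
  have hm0 : (m : ℂ) ≠ 0 := Nat.cast_ne_zero.mpr hm.ne'
  calc gjLocalZeta μ Ψ f s = (m : ℂ)⁻¹ * gjLocalZeta μ Ψav f s := by
        rw [h1, ← mul_assoc, inv_mul_cancel₀ hm0, one_mul]
    _ = _ := by rw [h2, Finset.mul_sum]; simp only [mul_assoc]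

/-! ### The zonal spherical function inside the zeta integral -/

omit [MeasurableSpace (GL (Fin n) F)] [BorelSpace (GL (Fin n) F)] in
/-- A smooth linear form is fixed by an open normal subgroup of the compact group `GL_n(𝒪)` under
the dual action (the open stabiliser contains a normal open subgroup of the profinite group `K`,
Mathlib `IsTopologicalGroup.exist_openNormalSubgroup_sub_clopen_nhds_of_one`). [folklore] -/
theorem exists_openNormalSubgroup_forall_dual_eq [CompactSpace (glInt n F)] {ψ : Module.Dual ℂ V}
    (hψ : ψ ∈ ρ.contragredient) :
    ∃ N : OpenNormalSubgroup (glInt n F), ∀ k ∈ N, ρ.dual ((k : glInt n F) : GL (Fin n) F) ψ = ψ := by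
  have hopen : IsOpen (((ρ.dual.stabilizerSubgroup ψ).subgroupOf (glInt n F) : Subgroup (glInt n F)) :
      Set (glInt n F)) :=
    Subgroup.subgroupOf_isOpen (glInt n F) _ hψ
  obtain ⟨N, hN⟩ := IsTopologicalGroup.exist_openNormalSubgroup_sub_clopen_nhds_of_one
    ⟨Subgroup.isClosed_of_isOpen _ hopen, hopen⟩ (Subgroup.one_mem _)
  exact ⟨N, fun k hk => Subgroup.mem_subgroupOf.1 (hN hk)⟩

/-- **The functional equation of the zonal spherical function, inside the zeta integral.** Let
`ρ` be smooth and spherical for `K = GL_n(𝒪)` (`dim V^K = 1`), `v ∈ V^K`, `φ ∈ Ṽ` a `K`-fixed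
smooth linear form with `φ(v) = 1`, `ω(g) = φ(ρ(g) v)` the zonal spherical coefficient, `μ` left
invariant, and suppose all `Z(1_M, s, ⟨ρ(·) v, φ'⟩)` (`φ' ∈ Ṽ`) converge absolutely. Then for
every `z ∈ GL_n(F)`,
`Z(1_{M}(z⁻¹ ·), s, ω) = |det z|^s · ω(z) · Z(1_M, s, ω)`, `M = M_n(𝒪)`.
Proof: `Z(1_M(z⁻¹ ·), s, ω) = |det z|^s Z(1_M, s, ⟨ρ(·) v, ψ⟩)` with `ψ = ρ̃(z⁻¹) φ`
(`gjLocalZeta_matrixCoeff_dual`); the `K`-average `Ψ' = ∑_{K/N} ρ̃(q) ψ` over an open normal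
`N ≤ K` fixing `ψ` is a `K`-invariant smooth form, hence `Ψ' = Ψ'(v) φ`
(`IsSmooth.dual_eq_zero_of_forall_mem_fixedPoints` with `V^K = ℂ v`, `eq_smul_of_isSpherical`),
`Ψ'(v) = [K:N] ψ(v) = [K:N] ω(z)`, while each `ρ̃(q) ψ` has the same zeta integral against `1_M`
as `ψ` (`1_M(q ·) = 1_M`). This is `∫_K ω(z k x) dk = ω(z) ω(x)` integrated against
`1_M(x) |det x|^s` (Cartier (1979), §IV). [folklore] -/
theorem gjLocalZeta_indicator_mul_left_eq_spherical [μ.IsMulLeftInvariant] (hρ : ρ.IsSmooth)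
    (hsph : ρ.IsSpherical (glInt n F)) {v : V} (hv : v ∈ ρ.fixedPoints (glInt n F))
    {φ : Module.Dual ℂ V} (hφ : φ ∈ ρ.contragredient) (hφK : φ ∈ ρ.dual.fixedPoints (glInt n F))
    (h1 : φ v = 1) (z : GL (Fin n) F) (s : ℂ)
    (hint : ∀ φ' ∈ ρ.contragredient,
      Integrable (gjLocalIntegrand ((intMatrices n F).indicator 1) (ρ.matrixCoeff φ' v) s) μ) :
    gjLocalZeta μ (fun X => (intMatrices n F).indicator 1
        ((((z⁻¹ : GL (Fin n) F)) : Matrix (Fin n) (Fin n) F) * X)) (ρ.matrixCoeff φ v) s =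
      (((normAbs F ((Matrix.GeneralLinearGroup.det z : Fˣ) : F) : ℝ≥0) : ℝ) : ℂ) ^ s *
        ρ.matrixCoeff φ v z * gjLocalZeta μ ((intMatrices n F).indicator 1) (ρ.matrixCoeff φ v) s := by
  classical
  set Φ₀ : Matrix (Fin n) (Fin n) F → ℂ := (intMatrices n F).indicator 1 with hΦ₀
  set K : Subgroup (GL (Fin n) F) := glInt n F with hKdef
  haveI : CompactSpace K := isCompact_iff_compactSpace.mp (isCompact_glInt n F)
  -- the translated form `ψ = ρ̃(z⁻¹) φ`
  set ψ : Module.Dual ℂ V := ρ.dual z⁻¹ φ with hψdef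
  have hψ : ψ ∈ ρ.contragredient := ρ.contragredient.apply_mem_toSubmodule z⁻¹ hφ
  have hψv : ψ v = ρ.matrixCoeff φ v z := by
    simp only [hψdef, Representation.dual_apply, Module.Dual.transpose_apply, LinearMap.comp_apply,
      inv_inv, Representation.matrixCoeff_apply]
  -- step 1: move `z` from the test function to the linear form
  have step1 : gjLocalZeta μ Φ₀ (ρ.matrixCoeff ψ v) s =
      (((normAbs F ((Matrix.GeneralLinearGroup.det z⁻¹ : Fˣ) : F) : ℝ≥0) : ℝ) : ℂ) ^ s *
        gjLocalZeta μ (fun X => Φ₀ ((((z⁻¹ : GL (Fin n) F)) : Matrix (Fin n) (Fin n) F) * X))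
          (ρ.matrixCoeff φ v) s :=
    gjLocalZeta_matrixCoeff_dual ρ μ Φ₀ φ v z⁻¹ s
  -- step 2: average `ψ` over `K / N`
  obtain ⟨N, hN⟩ := exists_openNormalSubgroup_forall_dual_eq ρ hψ
  haveI : Fintype (K ⧸ N.toSubgroup) := Fintype.ofFinite _
  set Ψ' : Module.Dual ℂ V := ∑ q : K ⧸ N.toSubgroup, ρ.dual ((q.out : K) : GL (Fin n) F) ψ with hΨ'def
  have hΨ'K : Ψ' ∈ ρ.dual.fixedPoints K := ρ.dual.sum_quotient_out_apply_mem_fixedPoints N.toSubgroup hN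
  have hΨ'inv : ∀ g ∈ K, ∀ w : V, Ψ' (ρ g w) = Ψ' w := by
    intro g hg w
    have h := (ρ.dual.mem_fixedPoints K Ψ').1 hΨ'K g⁻¹ (K.inv_mem hg)
    have := congrArg (fun f : Module.Dual ℂ V => f w) h
    simpa only [Representation.dual_apply, Module.Dual.transpose_apply, LinearMap.comp_apply,
      inv_inv] using this
  have hφinv : ∀ g ∈ K, ∀ w : V, φ (ρ g w) = φ w := by
    intro g hg w
    have h := (ρ.dual.mem_fixedPoints K φ).1 hφK g⁻¹ (K.inv_mem hg)
    have := congrArg (fun f : Module.Dual ℂ V => f w) h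
    simpa only [Representation.dual_apply, Module.Dual.transpose_apply, LinearMap.comp_apply,
      inv_inv] using this
  -- `Ψ' = Ψ'(v) φ`
  have hΨ'eq : Ψ' = Ψ' v • φ := by
    have h0 := hρ.dual_eq_zero_of_forall_mem_fixedPoints (isCompact_glInt n F) (Ψ' - Ψ' v • φ)
      (fun g hg w => by
        simp only [LinearMap.sub_apply, LinearMap.smul_apply, hΨ'inv g hg w, hφinv g hg w])
      (fun w hw => by
        rw [eq_smul_of_isSpherical ρ hsph hv h1 hw]
        simp only [LinearMap.sub_apply, LinearMap.smul_apply, map_smul, smul_eq_mul, h1]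
        ring)
    exact sub_eq_zero.mp h0
  -- `Ψ'(v) = [K : N] ω(z)`
  have hΨ'v : Ψ' v = (Fintype.card (K ⧸ N.toSubgroup) : ℂ) * ρ.matrixCoeff φ v z := by
    rw [hΨ'def, LinearMap.sum_apply, ← hψv]
    have : ∀ q : K ⧸ N.toSubgroup, ρ.dual ((q.out : K) : GL (Fin n) F) ψ v = ψ v := by
      intro q
      simp only [Representation.dual_apply, Module.Dual.transpose_apply, LinearMap.comp_apply]
      rw [(ρ.mem_fixedPoints K v).1 hv _ (K.inv_mem (q.out).2)]
    rw [Finset.sum_congr rfl fun q _ => this q, Finset.sum_const, Finset.card_univ, nsmul_eq_mul]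
  -- each summand has the same zeta integral against `1_M`
  have hq : ∀ q : K ⧸ N.toSubgroup,
      gjLocalZeta μ Φ₀ (ρ.matrixCoeff (ρ.dual ((q.out : K) : GL (Fin n) F) ψ) v) s =
        gjLocalZeta μ Φ₀ (ρ.matrixCoeff ψ v) s := by
    intro q
    rw [gjLocalZeta_matrixCoeff_dual, cpow_normAbs_det_of_mem_glInt (q.out).2, one_mul]
    congr 1
    funext X
    exact indicator_intMatrices_glInt_mul (q.out).2 X
  have hsum : (Fintype.card (K ⧸ N.toSubgroup) : ℂ) * gjLocalZeta μ Φ₀ (ρ.matrixCoeff ψ v) s =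
      gjLocalZeta μ Φ₀ (ρ.matrixCoeff Ψ' v) s := by
    rw [hΨ'def, gjLocalZeta_matrixCoeff_sum_left ρ μ Finset.univ Φ₀ _ v s (fun q _ =>
      hint _ (ρ.contragredient.apply_mem_toSubmodule _ hψ)), Finset.sum_congr rfl fun q _ => hq q,
      Finset.sum_const, Finset.card_univ, nsmul_eq_mul]
  have hcard : (Fintype.card (K ⧸ N.toSubgroup) : ℂ) ≠ 0 := Nat.cast_ne_zero.mpr Fintype.card_ne_zero
  have step2 : gjLocalZeta μ Φ₀ (ρ.matrixCoeff ψ v) s =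
      ρ.matrixCoeff φ v z * gjLocalZeta μ Φ₀ (ρ.matrixCoeff φ v) s := by
    apply mul_left_cancel₀ hcard
    rw [hsum, hΨ'eq, gjLocalZeta_matrixCoeff_smul_left, hΨ'v, mul_assoc]
  -- combine
  have hdet : (((normAbs F ((Matrix.GeneralLinearGroup.det z : Fˣ) : F) : ℝ≥0) : ℝ) : ℂ) ^ s *
      (((normAbs F ((Matrix.GeneralLinearGroup.det z⁻¹ : Fˣ) : F) : ℝ≥0) : ℝ) : ℂ) ^ s = 1 := by
    rw [← cpow_normAbs_det_mul, mul_inv_cancel, cpow_normAbs_det_of_mem_glInt (Subgroup.one_mem _)]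
  calc gjLocalZeta μ (fun X => Φ₀ ((((z⁻¹ : GL (Fin n) F)) : Matrix (Fin n) (Fin n) F) * X))
        (ρ.matrixCoeff φ v) s
      = (((normAbs F ((Matrix.GeneralLinearGroup.det z : Fˣ) : F) : ℝ≥0) : ℝ) : ℂ) ^ s *
          gjLocalZeta μ Φ₀ (ρ.matrixCoeff ψ v) s := by
        rw [step1, ← mul_assoc, hdet, one_mul]
    _ = _ := by rw [step2, mul_assoc]

end Zeta

end Literature.NumberTheory.Automorphic
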